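import Literature.AlgebraicGeometry.Motives.AbelianVarietyIdentityComponent
import Literature.AlgebraicGeometry.Motives.AbelianVarietyKummerBound
import Literature.AlgebraicGeometry.Motives.AbelianVarietyTheoremOfCube
import Literature.AlgebraicGeometry.Motives.AbelianVarietyTorsionFiniteProofs
import Literature.AlgebraicGeometry.Motives.SeesawTheorem
import HarnessLib

/-!
# Translation-invariant ample classes: `dim B = 0`, and finiteness of closed subgroups on which an
# ample class is translation-invariant (Mumford, *Abelian Varieties*, §6, Application 1; §19)

Two classical finiteness statements for an abelian variety over an algebraically closed field `K`,
proved here **granted the two seesaw facts** of `Motives/SeesawTheorem`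
(`seesaw_isClosed_trivialLocus`, `seesaw_exists_linEquiv_classPullback`: Görtz–Wedhorn II,
Thm. 24.66 — the same named facts from which the tree proves the theorem of the cube,
`theoremOfCube_linEquiv_of_seesaw`), in the divisor-class language of `Motives/CartierDivisor`:

* `AbelianVariety.dim_eq_zero_of_isAmple_of_forall_linEquiv` — **an abelian variety `B` carrying an
  ample divisor `D` with `t_b^* D ∼ D` for all `b ∈ B(K)` is a point** (Mumford §6, the argument of
  Application 1, p. 60, and §8 (iv)): Mumford's class `Λ(D) = m^*D - p₁^*D - p₂^*D` on `B × B`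
  (`mumfordDiv`) is trivial on the fibres of `p₂` over closed points (by hypothesis), hence over all
  points (closedness of the trivial locus; closed points are dense), so `Λ(D) ∼ p₂^* M₀` (seesaw) with
  `M₀ ∼ Λ(D)|_{e × B} ∼ 0`; restricting `Λ(D) ∼ 0` to the antidiagonal `x ↦ (x, x⁻¹)` gives
  `D + ι^*D ∼ 0`, an ample class, so `B` is finite over `K`
  (`CartierDivisor.isFinite_of_isAmple_of_linEquiv_zero`, Görtz–Wedhorn I, Cor. 13.82).
* `AbelianVariety.finite_of_forall_translation_linEquiv` — **closed subgroups on which an ample class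
  is translation-invariant are finite**: for an abelian subvariety `w : W ↪ X`, `D` ample on `X` and
  a closed `N ⊆ W` with `N(K)` a subgroup such that `(t_{w(P)}^* D - D)|_W ∼ 0` for all `P ∈ N(K)`,
  the set `N` is finite — the identity component `B` of `N`
  (`Motives/AbelianVarietyIdentityComponent`, `Motives/AbelianVarietyKernelComponent.redSub`) carries
  the translation-invariant ample class `D|_B`, so `B = {e}`, and `N` is a finite union of translates
  of `B` (`exists_finite_subset_iUnion_translation`). With `W = X` and `N = K(D)` this is the
  finiteness of `K(L)` for `L` ample (Mumford §6, Application 1 / §8); with `W = Y` an abelian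
  subvariety it is the finiteness of `Y ∩ Y^⊥` in Poincaré's reducibility theorem (§19, Thm. 1).

No named facts are introduced; the seesaw facts enter as hypotheses `hA`, `hB`.

Mathlib searched (pin): `pointOfClosedPoint`, `LocallyOfFiniteType.jacobsonSpace`,
`closure_closedPoints`, `Scheme.Hom.isDiscrete_preimage_singleton`,
`Order.krullDim_nonpos_of_subsingleton` (used); no line bundles / `Pic` / seesaw in Mathlib.
In this tree (used): `CartierDivisor.classPullback` calculus (`classPullback_comp_linEquiv`,
`classPullback_add_linEquiv`, `classPullback_neg_linEquiv`, `classPullback_id_linEquiv`,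
`classPullback_linEquiv_zero_of_const`), `CartierDivisor.neg`, `IsAmple.add`,
`IsAmple.classPullback`, `isFinite_of_isAmple_of_linEquiv_zero`, `CartierDivisor.trivialLocus`,
`residuePtι_apply_eq`, `AbelianVariety.translation`, `pointOfClosed`, `zsmulPt_neg_one_eq_inv`,
`subsingleton_left_of_dim_eq_zero`.

## References

* D. Mumford, *Abelian Varieties*, TIFR Studies in Mathematics 5, OUP (1970): §6, Application 1
  (p. 60) and its proof; §8 (iv); §19, Thm. 1 (proof, p. 173). [MumfordAV1970]
* U. Görtz, T. Wedhorn, *Algebraic Geometry II*, Springer Spektrum (2023): Thm. 24.66 (seesaw),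
  pp. 542–546; Prop. 27.186 (proof, p. 887: the same "ample and trivial ⇒ finite" argument).
  [GortzWedhorn2023]
* U. Görtz, T. Wedhorn, *Algebraic Geometry I*, 2nd ed. (2020): Cor. 13.82 (p. 515). [GortzWedhorn2020]
-/

universe u

open CategoryTheory CategoryTheory.Limits AlgebraicGeometry MonoidalCategory CartesianMonoidalCategory
open TopologicalSpace Topology

noncomputable section

namespace Literature.AlgebraicGeometry.Motives

open scoped MonObj
open Scheme.IdealSheafData

namespace AbelianVariety

variable {K : Type u} [Field K] (B : AbelianVariety K)

/-- **Mumford's divisor** `Λ(D) = m^*D - p₁^*D - p₂^*D` on `B × B` (divisor classes).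
[folklore] -/
def mumfordDiv (D : CartierDivisor B.X.left) : CartierDivisor (B.X ⊗ B.X).left :=
  D.classPullback (μ[B.X]).left +
    (-(D.classPullback (CartesianMonoidalCategory.fst B.X B.X).left) +
      -(D.classPullback (CartesianMonoidalCategory.snd B.X B.X).left))

variable {B}

/-- The class of `Λ(D)` along `φ = (x₁, x₂) : T → B × B` is `(x₁x₂)^*D - x₁^*D - x₂^*D`.
[folklore] -/
theorem classPullback_mumfordDiv_linEquiv {T : SchemeOver K} [IsIntegral T.left]
    (D : CartierDivisor B.X.left) (φ : T ⟶ B.X ⊗ B.X) :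
    ((mumfordDiv B D).classPullback φ.left).LinEquiv
      (D.classPullback ((φ ≫ CartesianMonoidalCategory.fst _ _) *
          (φ ≫ CartesianMonoidalCategory.snd _ _)).left +
        (-(D.classPullback (φ ≫ CartesianMonoidalCategory.fst _ _).left) +
          -(D.classPullback (φ ≫ CartesianMonoidalCategory.snd _ _).left))) := by
  have hμ : (φ ≫ CartesianMonoidalCategory.fst _ _) * (φ ≫ CartesianMonoidalCategory.snd _ _) =
      φ ≫ μ[B.X] := by
    rw [← MonObj.comp_mul, Hom.mul_def, CartesianMonoidalCategory.lift_fst_snd, Category.id_comp]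
  have hc : ∀ g : B.X ⊗ B.X ⟶ B.X, ((D.classPullback g.left).classPullback φ.left).LinEquiv
      (D.classPullback (φ ≫ g).left) := fun g => by
    rw [Over.comp_left]; exact (D.classPullback_comp_linEquiv g.left φ.left).symm
  have hn : ∀ g : B.X ⊗ B.X ⟶ B.X, ((-(D.classPullback g.left)).classPullback φ.left).LinEquiv
      (-(D.classPullback (φ ≫ g).left)) := fun g =>
    (CartierDivisor.classPullback_neg_linEquiv φ.left _).trans (hc g).neg
  unfold mumfordDiv
  refine (CartierDivisor.classPullback_add_linEquiv φ.left _ _).trans ?_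
  refine ((hc _).add ((CartierDivisor.classPullback_add_linEquiv φ.left _ _).trans
    ((hn _).add (hn _)))).trans ?_
  rw [hμ]
  exact CartierDivisor.LinEquiv.refl _

/-- If `(x₁x₂)^*D ∼ E`, `x₁^*D ∼ E₁`, `x₂^*D ∼ E₂` and `E ∼ E₁ + E₂` hold, then the class of
`Λ(D)` along `(x₁, x₂)` is trivial. [folklore] -/
theorem classPullback_mumfordDiv_linEquiv_zero {T : SchemeOver K} [IsIntegral T.left]
    (D : CartierDivisor B.X.left) (φ : T ⟶ B.X ⊗ B.X) {E₁ E₂ : CartierDivisor T.left}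
    (h₁ : (D.classPullback (φ ≫ CartesianMonoidalCategory.fst _ _).left).LinEquiv E₁)
    (h₂ : (D.classPullback (φ ≫ CartesianMonoidalCategory.snd _ _).left).LinEquiv E₂)
    (h : (D.classPullback ((φ ≫ CartesianMonoidalCategory.fst _ _) *
        (φ ≫ CartesianMonoidalCategory.snd _ _)).left).LinEquiv (E₁ + E₂)) :
    ((mumfordDiv B D).classPullback φ.left).LinEquiv 0 := by
  refine (classPullback_mumfordDiv_linEquiv D φ).trans ?_
  refine (h.add (h₁.neg.add h₂.neg)).trans ?_
  -- `(E₁ + E₂) + (-E₁ + -E₂) ∼ 0`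
  exact ((CartierDivisor.LinEquiv.refl _).add
    (CartierDivisor.neg_add_rev_sameDivisor E₁ E₂).linEquiv.symm).trans
    (CartierDivisor.add_neg_sameDivisor _).linEquiv

/-- The unit `1 : T → B` of `Hom_K(T, B)` has trivial class pullbacks (it is constant).
[folklore] -/
theorem classPullback_one_linEquiv_zero {T : SchemeOver K} [IsIntegral T.left]
    (D : CartierDivisor B.X.left) : (D.classPullback (1 : T ⟶ B.X).left).LinEquiv 0 :=
  CartierDivisor.classPullback_linEquiv_zero_of_const _ (fun a a' => by
    rw [one_left, Scheme.Hom.comp_apply, Scheme.Hom.comp_apply,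
      Subsingleton.elim (T.hom a) (T.hom a')]) D

section TI

variable [IsAlgClosed K]

/-- **An abelian variety carrying a translation-invariant ample divisor class is a point**
(Mumford, *Abelian Varieties*, §6, proof of Application 1, p. 60 / §8 (iv): "if `K(L) = X` then
[...] `L ⊗ (-1)^*L` is trivial [...] if `L` is ample, `X` is a point"), granted the two seesaw
facts of `Motives/SeesawTheorem`: if `D` is ample on `B` and `t_b^* D ∼ D` for all `b ∈ B(K)`
(`K` algebraically closed), then `Λ(D)` is trivial on all fibres of `p₂ : B × B → B` (at closed
points by hypothesis, hence everywhere by closedness of the trivial locus), so `Λ(D) ∼ p₂^* M₀` with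
`M₀ ∼ Λ(D)|_{e × B} ∼ 0`; restricting `Λ(D) ∼ 0` to the antidiagonal gives `D + (-1)^*D ∼ 0`, an
ample class, so `B` is finite over `K`, i.e. `dim B = 0`. [cite: MumfordAV1970, §6 Application 1 (proof)] -/
theorem dim_eq_zero_of_isAmple_of_forall_linEquiv (hA : seesaw_isClosed_trivialLocus.{u})
    (hB : seesaw_exists_linEquiv_classPullback.{u}) {D : CartierDivisor B.X.left} (hD : D.IsAmple)
    (hinv : ∀ P : B.Points K, (D.classPullback (B.translation P).left).LinEquiv D) :
    B.dim = 0 := by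
  set Λ := mumfordDiv B D with hΛ
  -- (i) every `K`-point lies in the trivial locus
  have hpt : ∀ (t₀ : 𝟙_ (SchemeOver K) ⟶ B.X) (s : (𝟙_ (SchemeOver K)).left),
      (D.classPullback ((𝟙 B.X) * (CartesianMonoidalCategory.toUnit _ ≫ t₀)).left).LinEquiv D →
      t₀.left s ∈ CartierDivisor.trivialLocus B.X B.X Λ := fun t₀ s hinv0 => by
    rw [CartierDivisor.mem_trivialLocus_iff, residuePtι_apply_eq]
    -- the fibre factors through the slice `x ↦ (x, t₀)`
    have e : B.X ◁ (CartesianMonoidalCategory.toUnit (residuePt B.X (t₀.left s)) ≫ t₀) =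
        CartesianMonoidalCategory.fst B.X (residuePt B.X (t₀.left s)) ≫ (ρ_ B.X).inv ≫ B.X ◁ t₀ := by
      ext <;> simp
    rw [e, Over.comp_left]
    refine (Λ.classPullback_comp_linEquiv _ _).trans (CartierDivisor.LinEquiv.classPullback_zero _ ?_)
    refine classPullback_mumfordDiv_linEquiv_zero D _ (E₁ := D) (E₂ := 0) ?_ ?_ ?_
    · have e1 : ((ρ_ B.X).inv ≫ B.X ◁ t₀) ≫ CartesianMonoidalCategory.fst _ _ = 𝟙 _ := by simp
      rw [e1, Over.id_left]; exact D.classPullback_id_linEquiv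
    · have e2 : ((ρ_ B.X).inv ≫ B.X ◁ t₀) ≫ CartesianMonoidalCategory.snd _ _ =
          CartesianMonoidalCategory.toUnit _ ≫ t₀ := by simp
      rw [e2]
      exact CartierDivisor.classPullback_linEquiv_zero_of_const _ (fun a a' => by
        have hs : (CartesianMonoidalCategory.toUnit B.X).left a =
            (CartesianMonoidalCategory.toUnit B.X).left a' :=
          Subsingleton.elim (α := ↥(Spec (CommRingCat.of K))) _ _
        rw [Over.comp_left, Scheme.Hom.comp_apply, Scheme.Hom.comp_apply, hs]) D
    · have e1 : ((ρ_ B.X).inv ≫ B.X ◁ t₀) ≫ CartesianMonoidalCategory.fst _ _ = 𝟙 _ := by simp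
      have e2 : ((ρ_ B.X).inv ≫ B.X ◁ t₀) ≫ CartesianMonoidalCategory.snd _ _ =
          CartesianMonoidalCategory.toUnit _ ≫ t₀ := by simp
      rw [e1, e2]
      exact hinv0.trans (D.add_zero_sameDivisor).linEquiv.symm
  -- (ii) hence every point does (closed points are `K`-points and dense)
  have hZ : IsClosed (CartierDivisor.trivialLocus B.X B.X Λ) := hA K B.X B.X Λ
  haveI : JacobsonSpace B.X.left := LocallyOfFiniteType.jacobsonSpace B.X.hom
  have hall : ∀ t : B.X.left, t ∈ CartierDivisor.trivialLocus B.X B.X Λ := by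
    have hcl : closedPoints B.X.left ⊆ CartierDivisor.trivialLocus B.X B.X Λ := fun x hx => by
      let t₀ : 𝟙_ (SchemeOver K) ⟶ B.X := Over.homMk (pointOfClosedPoint B.X.hom x hx)
        (by simp)
      have ht₀ : t₀.left (IsLocalRing.closedPoint K) = x := pointOfClosedPoint_apply B.X.hom x hx _
      -- the translation by the rational point `x` in the two forms
      have e0 : CartesianMonoidalCategory.toUnit B.X ≫ t₀ = toSpecOver B.X ≫ B.pointOfClosed x hx := by
        ext1
        rw [Over.comp_left, Over.comp_left, Over.toUnit_left, toSpecOver_left]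
        rfl
      have e : (𝟙 B.X) * (CartesianMonoidalCategory.toUnit _ ≫ t₀) =
          B.translation (B.pointOfClosed x hx) := by
        unfold translation
        rw [mul_comm, e0]
      rw [← ht₀]
      refine hpt t₀ _ ?_
      rw [e]
      exact hinv _
    intro t
    have ht : t ∈ closure (closedPoints B.X.left) := by rw [closure_closedPoints]; trivial
    exact closure_minimal hcl hZ ht
  -- (iii) seesaw: `Λ ∼ p₂^* M₀`, and `M₀ ∼ Λ|_{e × B} ∼ 0`
  obtain ⟨M₀, hM₀⟩ := hB K B.X B.X Λ hall
  have hτ : (Λ.classPullback ((λ_ B.X).inv ≫ η[B.X] ▷ B.X).left).LinEquiv 0 := by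
    refine classPullback_mumfordDiv_linEquiv_zero D _ (E₁ := 0) (E₂ := D) ?_ ?_ ?_
    · have e1 : ((λ_ B.X).inv ≫ η[B.X] ▷ B.X) ≫ CartesianMonoidalCategory.fst _ _ = 1 := by
        rw [Hom.one_def]; simp
      rw [e1]; exact classPullback_one_linEquiv_zero D
    · have e2 : ((λ_ B.X).inv ≫ η[B.X] ▷ B.X) ≫ CartesianMonoidalCategory.snd _ _ = 𝟙 _ := by simp
      rw [e2, Over.id_left]; exact D.classPullback_id_linEquiv
    · have e1 : ((λ_ B.X).inv ≫ η[B.X] ▷ B.X) ≫ CartesianMonoidalCategory.fst _ _ = 1 := by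
        rw [Hom.one_def]; simp
      have e2 : ((λ_ B.X).inv ≫ η[B.X] ▷ B.X) ≫ CartesianMonoidalCategory.snd _ _ = 𝟙 _ := by simp
      rw [e1, e2, one_mul, Over.id_left]
      exact D.classPullback_id_linEquiv.trans (D.zero_add_sameDivisor).linEquiv.symm
  have hM₀0 : M₀.LinEquiv 0 := by
    have e : ((λ_ B.X).inv ≫ η[B.X] ▷ B.X) ≫ CartesianMonoidalCategory.snd B.X B.X = 𝟙 _ := by simp
    have h := M₀.classPullback_comp_linEquiv (CartesianMonoidalCategory.snd B.X B.X).left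
      ((λ_ B.X).inv ≫ η[B.X] ▷ B.X).left
    rw [← Over.comp_left, e, Over.id_left] at h
    exact (M₀.classPullback_id_linEquiv.symm.trans h).trans
      (((hM₀.classPullback _).symm).trans hτ)
  have hΛ0 : Λ.LinEquiv 0 := hM₀.trans (hM₀0.classPullback_zero _)
  -- (iv) restrict to the antidiagonal `x ↦ (x, x⁻¹)`: `D + ι^*D ∼ 0`
  set F := D.classPullback ((𝟙 B.X)⁻¹).left with hF
  have hd : (D + F).LinEquiv 0 := by
    set d : B.X ⟶ B.X ⊗ B.X := CartesianMonoidalCategory.lift (𝟙 B.X) (𝟙 B.X)⁻¹ with hdd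
    have e1 : d ≫ CartesianMonoidalCategory.fst _ _ = 𝟙 _ := CartesianMonoidalCategory.lift_fst _ _
    have e2 : d ≫ CartesianMonoidalCategory.snd _ _ = (𝟙 B.X)⁻¹ := CartesianMonoidalCategory.lift_snd _ _
    have h1 : (Λ.classPullback d.left).LinEquiv (0 + (-D + -F)) := by
      refine (classPullback_mumfordDiv_linEquiv D d).trans ?_
      rw [e1, e2, mul_inv_cancel, Over.id_left]
      exact (classPullback_one_linEquiv_zero D).add
        (D.classPullback_id_linEquiv.neg.add (CartierDivisor.LinEquiv.refl _))
    have h2 : (Λ.classPullback d.left).LinEquiv 0 := hΛ0.classPullback_zero _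
    have h3 : (-D + -F).LinEquiv 0 :=
      ((CartierDivisor.zero_add_sameDivisor _).linEquiv.symm.trans h1.symm).trans h2
    -- `D + F ∼ (D + F) + (-D + -F) ∼ (D + -D) + (F + -F) ∼ 0`
    have h4 : (D + F).LinEquiv (D + F + (-D + -F)) :=
      (CartierDivisor.add_zero_sameDivisor _).linEquiv.symm.trans
        ((CartierDivisor.LinEquiv.refl _).add h3.symm)
    refine h4.trans ?_
    refine (CartierDivisor.add_add_add_comm_sameDivisor D F (-D) (-F)).linEquiv.trans ?_
    exact ((D.add_neg_sameDivisor).linEquiv.add (F.add_neg_sameDivisor).linEquiv).trans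
      (CartierDivisor.add_zero_sameDivisor _).linEquiv
  -- (v) `D + ι^*D` is ample, so `B` is finite over `K`
  haveI : IsAffineHom ((𝟙 B.X)⁻¹).left := by
    rw [Hom.inv_def, Category.id_comp]
    haveI : IsIso (ι[B.X]).left := by
      have := (zsmulPt_neg_one_eq_inv B)
      rw [Hom.inv_def, Category.id_comp] at this
      rw [← this]; infer_instance
    infer_instance
  have hamp : (D + F).IsAmple := hD.add (hD.classPullback ((𝟙 B.X)⁻¹).left)
  haveI : IsFinite (B.X.hom : B.X.left ⟶ Spec (.of K)) :=
    CartierDivisor.isFinite_of_isAmple_of_linEquiv_zero _ hamp hd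
  -- (vi) a finite integral `K`-scheme is a point: `dim B = 0`
  haveI : DiscreteTopology B.X.left := by
    rw [← isDiscrete_univ_iff]
    have hdisc := (B.X.hom : B.X.left ⟶ Spec (.of K)).isDiscrete_preimage_singleton (specPt K)
    rwa [show ((B.X.hom : B.X.left ⟶ Spec (.of K)) ⁻¹' {specPt K} : Set B.X.left) = Set.univ from
      Set.eq_univ_of_forall fun z => eq_specPt K _] at hdisc
  haveI := irreducibleSpace_left B
  haveI : Subsingleton B.X.left := ⟨fun z z' => by
    by_contra hne
    obtain ⟨w, hw, hw'⟩ := nonempty_preirreducible_inter (isOpen_discrete {z})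
      (isOpen_discrete {z'}) ⟨z, rfl⟩ ⟨z', rfl⟩
    exact hne ((Set.mem_singleton_iff.mp hw).symm.trans (Set.mem_singleton_iff.mp hw'))⟩
  have hdim : topologicalKrullDim B.X.left ≤ 0 := by
    letI : PartialOrder B.X.left := specializationOrder _
    rw [Literature.Topology.topologicalKrullDim_eq_krullDim]
    exact Order.krullDim_nonpos_of_subsingleton
  rw [topologicalKrullDim_left] at hdim
  have : B.dim ≤ 0 := by exact_mod_cast hdim
  omega

end TI

section S2

/-- Homomorphisms commute with translations: `t_P ≫ j = j ≫ t_{P ≫ j}`. [folklore] -/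
theorem translation_comp_hom {B X : AbelianVariety K} (j : B ⟶ X) (P : B.Points K) :
    B.translation P ≫ j.hom.hom.hom = j.hom.hom.hom ≫ X.translation (P ≫ j.hom.hom.hom) := by
  unfold translation
  rw [MonObj.mul_comp, Category.id_comp, MonObj.comp_mul, Category.comp_id, Category.assoc,
    ← Category.assoc (j.hom.hom.hom) (toSpecOver X.X), comp_toSpecOver_eq']

variable [IsAlgClosed K]

/-- **Closed subgroups on which an ample class is translation-invariant are finite** (Mumford,
*Abelian Varieties*, §6, Application 1 / the finiteness of `K(L)` for `L` ample, and the form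
used in Poincaré's reducibility theorem, §19 Thm. 1), granted the two seesaw facts. Let
`w : W ↪ X` be an abelian subvariety, `D` ample on `X`, and `N ⊆ W` closed with `N(K)` a subgroup
such that `(t_{w(P)}^* D - D)|_W ∼ 0` for all `P ∈ N(K)`. Then `N` is finite: the identity
component `B` of `N` carries the ample class `D|_B`, translation-invariant under `B(K)`, so
`dim B = 0` (`dim_eq_zero_of_isAmple_of_forall_linEquiv`), `B = {e}`, and `N` is a finite union
of translates of `B`. [cite: MumfordAV1970, §6 Application 1 and §19 Thm. 1 (proof)] -/
theorem finite_of_forall_translation_linEquiv (hA : seesaw_isClosed_trivialLocus.{u})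
    (hB : seesaw_exists_linEquiv_classPullback.{u}) {X W : AbelianVariety K} (w : W ⟶ X)
    [IsClosedImmersion (Hom.toSchemeHom w)] {D : CartierDivisor X.X.left} (hD : D.IsAmple)
    {N : Set W.X.left} (hN : IsClosed N) (h1 : origin W ∈ N)
    (hNmul : ∀ P Q : W.Points K, P.left (IsLocalRing.closedPoint K) ∈ N →
      Q.left (IsLocalRing.closedPoint K) ∈ N → (P * Q).left (IsLocalRing.closedPoint K) ∈ N)
    (hNinv : ∀ P : W.Points K, P.left (IsLocalRing.closedPoint K) ∈ N →
      P⁻¹.left (IsLocalRing.closedPoint K) ∈ N)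
    (htriv : ∀ P : W.Points K, P.left (IsLocalRing.closedPoint K) ∈ N →
      ((D.classPullback (X.translation (P ≫ w.hom.hom.hom)).left + -D).classPullback
        (Hom.toSchemeHom w)).LinEquiv 0) :
    N.Finite := by
  -- the identity component `B` of `N`
  obtain ⟨C, hC, h1C, hCN, hmax⟩ := exists_maximal_irreducible_origin_mem hN h1
  have hδ := range_divMor_subset_of_maximal' hN hNmul hNinv C hC h1C hCN hmax
  set B := redSub C hC h1C hδ with hBdef
  set incl : B ⟶ W := redSubHom C hC h1C hδ with hincl
  set j : B ⟶ X := incl ≫ w with hj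
  haveI : IsClosedImmersion (Hom.toSchemeHom j) := by
    change IsClosedImmersion ((vanishingIdeal C).subschemeι ≫ Hom.toSchemeHom w); infer_instance
  -- `D|_B` is ample and translation-invariant
  set M := D.classPullback (Hom.toSchemeHom j) with hM
  have hMamp : M.IsAmple := hD.classPullback _
  have hinv : ∀ P : B.Points K, (M.classPullback (B.translation P).left).LinEquiv M := fun P => by
    have hPN : (P ≫ incl.hom.hom.hom).left (IsLocalRing.closedPoint K) ∈ N :=
      hCN (comp_redSubι_left_apply_mem C P _)
    have ht := htriv (P ≫ incl.hom.hom.hom) hPN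
    rw [Category.assoc] at ht
    -- restrict further to `B`
    have ht' : (((D.classPullback (X.translation (P ≫ j.hom.hom.hom)).left + -D).classPullback
        (Hom.toSchemeHom w)).classPullback (Hom.toSchemeHom incl)).LinEquiv 0 :=
      ht.classPullback_zero _
    have ht'' : ((D.classPullback (X.translation (P ≫ j.hom.hom.hom)).left + -D).classPullback
        (Hom.toSchemeHom j)).LinEquiv 0 := by
      have hc := (D.classPullback (X.translation (P ≫ j.hom.hom.hom)).left + -D).classPullback_comp_linEquiv
        (Hom.toSchemeHom w) (Hom.toSchemeHom incl)
      exact hc.trans ht'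
    have hsplit : ((D.classPullback (X.translation (P ≫ j.hom.hom.hom)).left).classPullback
        (Hom.toSchemeHom j)).LinEquiv M := by
      refine CartierDivisor.LinEquiv.of_add_neg ?_
      refine CartierDivisor.LinEquiv.trans ?_ ht''
      refine CartierDivisor.LinEquiv.symm ?_
      exact (CartierDivisor.classPullback_add_linEquiv _ _ _).trans
        ((CartierDivisor.LinEquiv.refl _).add (CartierDivisor.classPullback_neg_linEquiv _ _))
    -- `t^B_P ≫ j = j ≫ t^X_{P ≫ j}`
    have hcomm : (B.translation P).left ≫ Hom.toSchemeHom j =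
        Hom.toSchemeHom j ≫ (X.translation (P ≫ j.hom.hom.hom)).left := by
      have := congrArg CommaMorphism.left (translation_comp_hom j P)
      simpa only [Over.comp_left] using this
    have h1 : (M.classPullback (B.translation P).left).LinEquiv
        (D.classPullback ((B.translation P).left ≫ Hom.toSchemeHom j)) :=
      (D.classPullback_comp_linEquiv _ _).symm
    rw [hcomm] at h1
    exact h1.trans ((D.classPullback_comp_linEquiv _ _).trans hsplit)
  -- so `dim B = 0`: `B` is a point and `C = {e}`
  have hdim : B.dim = 0 := dim_eq_zero_of_isAmple_of_forall_linEquiv hA hB hMamp hinv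
  have hsub : Subsingleton (redSubOver C).left := subsingleton_left_of_dim_eq_zero B hdim
  have hC1 : (C : Set W.X.left) = {origin W} := by
    refine Set.Subset.antisymm (fun x hx => ?_) (Set.singleton_subset_iff.2 h1C)
    rw [← range_redSubι_left C] at hx
    obtain ⟨b, rfl⟩ := hx
    have h1' : origin W ∈ Set.range (redSubι C).left := by rw [range_redSubι_left]; exact h1C
    obtain ⟨b₀, hb₀⟩ := h1'
    rw [Set.mem_singleton_iff, ← hb₀, hsub.elim b b₀]
  -- `N` is a finite union of translates of the point `C`
  obtain ⟨I, hI, Q, -, hcov⟩ := exists_finite_subset_iUnion_translation hN hNmul hNinv C hC h1C hCN hmax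
  haveI := hI
  refine Set.Finite.subset (Set.finite_iUnion fun i => ?_) hcov
  rw [hC1, Set.image_singleton]
  exact Set.finite_singleton _

end S2

end AbelianVariety

end Literature.AlgebraicGeometry.Motives
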